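import Mathlib
import HarnessLib
import Literature.Analysis.ValidatedNumerics.FixedPointInterval
import Summits.NavierStokesRegularity.NavierStokesRegularity.Theorems.TaylorModelRungThreeCertificateScalar
import Summits.NavierStokesRegularity.NavierStokesRegularity.Theorems.TaylorModelRungThreeCertificateIntervalD

/-!
# Crux K1b-DR (stmt-NavierStokesRegularity-23954), line `taylor-model` — certificate SOUNDNESS tooling: the rounded-dyadic
# interval layer, part 2 — rounded DIVISION / POWERS and the ENCLOSURES of the certificate constants (`ofRat`, `sqrt2`, `ofQS2`)

Continuation of `…CertificateIntervalD.lean` (S1-VECTOR-23954 §5.5 (ii); director ruling dss_58 (A)): division of a dyadic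
floating interval by a positive natural number with outward rounding after a `prec`-bit up-shift (`divNat`, for the `1/(k+1)`
of the jet recursion), rounded natural powers (`powR`, for `h^k`), the enclosure of a rational at absolute precision `2^-prec` by integer floor/ceiling division
(`ofRat`), the enclosure of `√2` from the integer square root (`sqrt2`, `mem_sqrt2 : mem √2 (sqrt2 prec)`), and the BRIDGE
from the exact scalar field `QS2 = ℚ(√2)` of CERT-CONTRACT-23954 §1: `ofQS2 prec z` with
`mem_ofQS2 : mem (QS2.toRealHom z) (ofQS2 prec z)` — the one lemma through which exact table data (`coef`, centres, radii)
enter the interval arithmetic of the v3 checker. Two closing examples show that the whole pipeline (integer square root,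
floor/ceiling division, exponent alignment, directed rounding) evaluates in the kernel (`decide +kernel`). [folklore]

MODEL-lattice bookkeeping only (rung TL-M3, one finite-dimensional model ODE); nothing here concerns the Navier–Stokes equations.
-/

-- the sub-problem namespace repeats the summit name by design (D-0017)
set_option linter.dupNamespace false

namespace Summit.NavierStokesRegularity.NavierStokesRegularity.Theorems.TaylorModelCert

open Literature.Analysis.ValidatedNumerics

namespace IntervalD

/-- Division by a positive natural number, outward rounded after a `prec`-bit up-shift of the mantissas. [folklore] -/
def divNat (prec : ℕ) (I : IntervalD) (n : ℕ) : IntervalD :=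
  ⟨⟨(I.lo.m * ((2 ^ prec : ℕ) : ℤ)) / n, I.lo.e - prec⟩, ⟨Numerics.cdiv (I.hi.m * ((2 ^ prec : ℕ) : ℤ)) n, I.hi.e - prec⟩⟩

/-- Rounded natural power (repeated rounded product). [folklore] -/
def powR (prec : ℕ) (I : IntervalD) : ℕ → IntervalD
  | 0 => ofInt 1
  | k + 1 => mulR prec (powR prec I k) I

/-- Enclosure of a rational number at absolute precision `2^-prec` (floor / ceiling of `q · 2^prec`, computed by integer
division `num · 2^prec / den`). [folklore] -/
def ofRat (prec : ℕ) (q : ℚ) : IntervalD :=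
  ⟨⟨(q.num * ((2 ^ prec : ℕ) : ℤ)) / (q.den : ℤ), -(prec : ℤ)⟩,
   ⟨Numerics.cdiv (q.num * ((2 ^ prec : ℕ) : ℤ)) q.den, -(prec : ℤ)⟩⟩

/-- Enclosure of `√2` at absolute precision `2^-prec`: `[r, r+1] · 2^-prec` with `r = ⌊√(2·4^prec)⌋`. [folklore] -/
def sqrt2 (prec : ℕ) : IntervalD :=
  ⟨⟨(Nat.sqrt (2 * 4 ^ prec) : ℕ), -(prec : ℤ)⟩, ⟨((Nat.sqrt (2 * 4 ^ prec) + 1 : ℕ) : ℤ), -(prec : ℤ)⟩⟩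

/-- Enclosure of an element `a + b√2` of the exact scalar field `QS2 = ℚ(√2)` of the certificate. [folklore] -/
def ofQS2 (prec : ℕ) (z : QS2) : IntervalD :=
  roundOut prec (add (ofRat prec z.re) (mul (ofRat prec z.im) (sqrt2 prec)))

/-! #### Inclusion theorems -/

variable {x : ℝ} {I : IntervalD}

/-- [folklore] -/
theorem mem_divNat (prec : ℕ) (hx : mem x I) {n : ℕ} (hn : 0 < n) : mem (x / n) (divNat prec I n) := by
  obtain ⟨h1, h2⟩ := hx
  have hnz : (0 : ℤ) < (n : ℤ) := by exact_mod_cast hn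
  have hnr : (0 : ℝ) < n := by exact_mod_cast hn
  have epow : ∀ e : ℤ, (2 : ℝ) ^ prec * (2 : ℝ) ^ (e - prec) = (2 : ℝ) ^ e := fun e => by
    rw [← zpow_natCast, ← zpow_add₀ (by norm_num : (2 : ℝ) ≠ 0)]; congr 1; ring
  simp only [mem, divNat, Dyad.toReal] at h1 h2 ⊢
  set a : ℤ := I.lo.m * ((2 ^ prec : ℕ) : ℤ) with ha
  set b : ℤ := I.hi.m * ((2 ^ prec : ℕ) : ℤ) with hb
  have har : (a : ℝ) * (2 : ℝ) ^ (I.lo.e - prec) = (I.lo.m : ℝ) * (2 : ℝ) ^ I.lo.e := by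
    rw [ha]; push_cast; rw [mul_assoc, epow]
  have hbr : (b : ℝ) * (2 : ℝ) ^ (I.hi.e - prec) = (I.hi.m : ℝ) * (2 : ℝ) ^ I.hi.e := by
    rw [hb]; push_cast; rw [mul_assoc, epow]
  have hqa : (0 : ℝ) ≤ (2 : ℝ) ^ (I.lo.e - prec) := (zpow_pos (by norm_num) _).le
  have hqb : (0 : ℝ) ≤ (2 : ℝ) ^ (I.hi.e - prec) := (zpow_pos (by norm_num) _).le
  constructor
  · rw [le_div_iff₀ hnr]
    have hfl := Numerics.fdiv_mul_le_real (a := a) hnz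
    rw [Int.cast_natCast] at hfl
    have key := mul_le_mul_of_nonneg_right hfl hqa
    rw [har] at key
    calc ((a / n : ℤ) : ℝ) * (2 : ℝ) ^ (I.lo.e - prec) * n
        = ((a / n : ℤ) : ℝ) * n * (2 : ℝ) ^ (I.lo.e - prec) := by ring
      _ ≤ (I.lo.m : ℝ) * (2 : ℝ) ^ I.lo.e := key
      _ ≤ x := h1
  · rw [div_le_iff₀ hnr]
    have hce := Numerics.le_cdiv_mul_real (a := b) hnz
    rw [Int.cast_natCast] at hce
    have key := mul_le_mul_of_nonneg_right hce hqb
    rw [hbr] at key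
    calc x ≤ (I.hi.m : ℝ) * (2 : ℝ) ^ I.hi.e := h2
      _ ≤ ((Numerics.cdiv b n : ℤ) : ℝ) * n * (2 : ℝ) ^ (I.hi.e - prec) := key
      _ = ((Numerics.cdiv b n : ℤ) : ℝ) * (2 : ℝ) ^ (I.hi.e - prec) * n := by ring

/-- [folklore] -/
theorem mem_powR (prec : ℕ) (hx : mem x I) : ∀ k : ℕ, mem (x ^ k) (powR prec I k)
  | 0 => by simpa [powR] using mem_ofInt 1
  | k + 1 => by rw [pow_succ]; exact mem_mulR prec (mem_powR prec hx k) hx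

/-- [folklore] -/
theorem mem_ofRat (prec : ℕ) (q : ℚ) : mem (q : ℝ) (ofRat prec q) := by
  have hd : (0 : ℤ) < (q.den : ℤ) := by exact_mod_cast q.den_pos
  have hdr : (0 : ℝ) < q.den := by exact_mod_cast q.den_pos
  have h2n : (0 : ℝ) < (2 : ℝ) ^ (-(prec : ℤ)) := zpow_pos (by norm_num) _
  have hinv : (2 : ℝ) ^ prec * (2 : ℝ) ^ (-(prec : ℤ)) = 1 := by
    rw [← zpow_natCast, ← zpow_add₀ (by norm_num : (2 : ℝ) ≠ 0), add_neg_cancel, zpow_zero]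
  have hq : (q : ℝ) = (q.num : ℝ) / q.den := by exact_mod_cast (Rat.num_div_den q).symm
  set a : ℤ := q.num * ((2 ^ prec : ℕ) : ℤ) with ha
  have har : (a : ℝ) * (2 : ℝ) ^ (-(prec : ℤ)) = q.num := by
    rw [ha]; push_cast; rw [mul_assoc, hinv, mul_one]
  simp only [mem, ofRat, Dyad.toReal]
  constructor
  · have hfl := Numerics.fdiv_mul_le_real (a := a) hd
    rw [Int.cast_natCast] at hfl
    have key := mul_le_mul_of_nonneg_right hfl h2n.le
    rw [mul_right_comm, har] at key
    rw [hq, le_div_iff₀ hdr]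
    exact key
  · have hce := Numerics.le_cdiv_mul_real (a := a) hd
    rw [Int.cast_natCast] at hce
    have key := mul_le_mul_of_nonneg_right hce h2n.le
    rw [mul_right_comm, har] at key
    rw [hq, div_le_iff₀ hdr]
    exact key

/-- **`√2 ∈ sqrt2 prec`.** [folklore] -/
theorem mem_sqrt2 (prec : ℕ) : mem (Real.sqrt 2) (sqrt2 prec) := by
  set r := Nat.sqrt (2 * 4 ^ prec) with hr
  have h2p : (0 : ℝ) < (2 : ℝ) ^ (prec : ℤ) := zpow_pos (by norm_num) _
  have h2n : (0 : ℝ) < (2 : ℝ) ^ (-(prec : ℤ)) := zpow_pos (by norm_num) _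
  have hinv : (2 : ℝ) ^ (prec : ℤ) * (2 : ℝ) ^ (-(prec : ℤ)) = 1 := by
    rw [← zpow_add₀ (by norm_num : (2 : ℝ) ≠ 0), add_neg_cancel, zpow_zero]
  have h4 : (4 : ℝ) ^ prec = ((2 : ℝ) ^ (prec : ℤ)) ^ 2 := by
    rw [zpow_natCast, ← pow_mul, show (4 : ℝ) = 2 ^ 2 by norm_num, ← pow_mul, mul_comm]
  -- `r ≤ √2 · 2^prec ≤ r + 1`
  have hs : Real.sqrt ((2 * 4 ^ prec : ℕ) : ℝ) = Real.sqrt 2 * (2 : ℝ) ^ (prec : ℤ) := by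
    push_cast
    rw [h4, Real.sqrt_mul (by norm_num), Real.sqrt_sq h2p.le]
  have hlo : (r : ℝ) ≤ Real.sqrt 2 * (2 : ℝ) ^ (prec : ℤ) := by
    rw [← hs]
    calc (r : ℝ) = Real.sqrt ((r : ℝ) ^ 2) := (Real.sqrt_sq (by positivity)).symm
      _ ≤ Real.sqrt ((2 * 4 ^ prec : ℕ) : ℝ) := Real.sqrt_le_sqrt (by exact_mod_cast Nat.sqrt_le' (2 * 4 ^ prec))
  have hhi : Real.sqrt 2 * (2 : ℝ) ^ (prec : ℤ) ≤ ((r + 1 : ℕ) : ℝ) := by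
    rw [← hs]
    calc Real.sqrt ((2 * 4 ^ prec : ℕ) : ℝ) ≤ Real.sqrt ((((r + 1) ^ 2 : ℕ)) : ℝ) :=
          Real.sqrt_le_sqrt (by exact_mod_cast (Nat.lt_succ_sqrt' (2 * 4 ^ prec)).le)
      _ = ((r + 1 : ℕ) : ℝ) := by push_cast; exact Real.sqrt_sq (by positivity)
  simp only [mem, sqrt2, Dyad.toReal, Int.cast_natCast]
  constructor
  · have key := mul_le_mul_of_nonneg_right hlo h2n.le
    rwa [mul_assoc, hinv, mul_one] at key
  · have key := mul_le_mul_of_nonneg_right hhi h2n.le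
    rwa [mul_assoc, hinv, mul_one] at key

/-- **Exact certificate scalars enter the interval arithmetic**: `QS2.toRealHom z ∈ ofQS2 prec z`. [folklore] -/
theorem mem_ofQS2 (prec : ℕ) (z : QS2) : mem (QS2.toRealHom z) (ofQS2 prec z) := by
  rw [QS2.toRealHom_apply]
  exact mem_roundOut prec (mem_add (mem_ofRat prec z.re) (mem_mul (mem_ofRat prec z.im) (mem_sqrt2 prec)))

/-! #### Kernel evaluation (sanity) -/

/-- `(√2)² ∈ [2 - 2^-20, 2 + 2^-20]` at 30-bit precision, decided by the kernel. [folklore] -/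
example : subset (sqrR 30 (sqrt2 30)) ⟨⟨2 ^ 21 - 1, -20⟩, ⟨2 ^ 21 + 1, -20⟩⟩ = true := by decide +kernel

/-- `(1 + √2)/3 ∈ [843828, 843829] · 2^-20` (`(1 + √2)/3 = 0.8047378…`, `843828.8 · 2^-20`), decided by the kernel on the
rounded enclosure of the `QS2` element `1 + √2` divided by `3`. [folklore] -/
example : leLo ⟨843828, -20⟩ (divNat 30 (ofQS2 30 ⟨1, 1⟩) 3) = true ∧
    hiLe (divNat 30 (ofQS2 30 ⟨1, 1⟩) 3) ⟨843829, -20⟩ = true := by decide +kernel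

end IntervalD

end Summit.NavierStokesRegularity.NavierStokesRegularity.Theorems.TaylorModelCert
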